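import Literature.NumberTheory.QuadraticFields.QuadraticConjugationMinima
import Literature.NumberTheory.QuadraticFields.RealQuadraticInfrastructureDistance
import HarnessLib

/-!
# Reduced principal modules lie on the principal cycle (Jozsa's Theorem 4(c))

Topic `NumberTheory/QuadraticFields`; continues `QuadraticConjugationMinima.lean` and
`RealQuadraticPrincipalCycle.lean`. Theorem-and-definition file (no named facts). With
`O = J(δ) = ℤ + δℤ` the order of discriminant `D`, `x_n = stepⁿ δ` the principal expansion and
`Π_n = ∏_{k=1}^{n} φ_k` (`valProd`), we prove

* `mem_jmod_iterate_iff : J(x_n) = Π_n · O` (iterating `J(x') = φ'J(x)`), so `β_n = Π_n⁻¹ ∈ O` and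
  **`O = β_{n+1}ℤ + β_nℤ`** (`exists_coords_beta`; Jozsa §6.3: consecutive minima `α_i, α_{i+1}`
  span `𝒪`), with `β` decreasing to `0`, conjugates alternating in sign and increasing in size;
* **`eq_beta_of_isMinimum`** — a minimum `λ ∈ (0, 1]` of `O` is one of the `β_n` (the pinching
  argument of Jacobson–Williams Thm. 5.18 / Jozsa Prop. 29: `β_{n+1} < λ < β_n` is impossible);
* **`exists_iterate_eq_of_jmod_eq_smul`** (Jozsa Thm. 4(c), JW Thm. 5.18 with (5.33)): a *reduced*
  quotient `w` whose module is principal, `J(w) = κ·O` with `κ > 0` in `ℚ(√D)`, is a member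
  `x_n`, `1 ≤ n ≤ p`, of the principal cycle, and `κ = Π_n · εʲ` for an integer `j` — the giant
  step's result is on the cycle at the distance `log κ (mod R)`.

## References

* R. Jozsa, arXiv:quant-ph/0302134 (2003), §6.3 (Props. 25, 28, 29, Thm. 4). [Jozsa2003]
* M. J. Jacobson, Jr., H. C. Williams, *Solving the Pell Equation*, Springer (2009), §5.3
  Thm. 5.18, (5.11), (5.33). [JacobsonWilliams2008]
-/

noncomputable section

open scoped Classical

namespace Literature.NumberTheory.QuadraticFields

namespace QuadIrr

variable {D : ℕ}

/-! ### The modules along the principal expansion -/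

/-- `Π_{n+1} = Π_n · φ_{n+1}`. [cite: JacobsonWilliams2008, §3.1 (3.17)] -/
theorem valProd_succ (x₀ : QuadIrr D) (n : ℕ) :
    valProd x₀ (n + 1) = valProd x₀ n * (step^[n + 1] x₀).val := by
  unfold valProd; rw [Finset.prod_range_succ]

/-- `Π_n > 0` when `x₁, x₂, …` are reduced. [folklore] -/
theorem valProd_pos (hD : ¬ IsSquare D) {x₀ : QuadIrr D} (h : x₀.IsPreReduced) (n : ℕ) : 0 < valProd x₀ n := by
  unfold valProd
  exact Finset.prod_pos fun k _ => by linarith [(h.isReduced_iterate_succ hD k).2.2.1]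

/-- `Π_n ≥ 1`. [folklore] -/
theorem one_le_valProd (hD : ¬ IsSquare D) {x₀ : QuadIrr D} (h : x₀.IsPreReduced) (n : ℕ) : 1 ≤ valProd x₀ n := by
  unfold valProd
  exact Finset.one_le_prod fun k _ => (h.isReduced_iterate_succ hD k).2.2.1.le

/-- `Π_{n+2} > 2 Π_n` (`φφ' > 2`). [cite: JacobsonWilliams2008, §5.3 (φ_kφ_{k+1} > 2)] -/
theorem two_mul_valProd_lt (hD : ¬ IsSquare D) {x₀ : QuadIrr D} (h : x₀.IsPreReduced) (n : ℕ) :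
    2 * valProd x₀ n < valProd x₀ (n + 2) := by
  rw [valProd_succ, valProd_succ]
  have h1 := two_lt_val_mul_val_step hD (h.isReduced_iterate_succ hD n)
  rw [← Function.iterate_succ_apply' step (n + 1)] at h1
  have h0 := valProd_pos hD h n
  nlinarith

/-- `Π_n` is in `ℚ(√D)`. [folklore] -/
theorem isQD_valProd (x₀ : QuadIrr D) (n : ℕ) : IsQD D (valProd x₀ n) :=
  IsQD.prod (fun _ => isQD_val _) n

/-- **`J(x_n) = Π_n · J(x₀)`** along the expansion of a pre-reduced `x₀`. [cite: JacobsonWilliams2008, §5.1 (5.10) (𝔞_j = θ_j 𝔞_1)] -/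
theorem mem_jmod_iterate_iff (hD : ¬ IsSquare D) {x₀ : QuadIrr D} (h : x₀.IsPreReduced) :
    ∀ (n : ℕ) (t : ℝ), t ∈ jmod (step^[n] x₀) ↔ ∃ s ∈ jmod x₀, t = valProd x₀ n * s
  | 0, t => by simp [valProd]
  | n + 1, t => by
    have hadm : (step^[n] x₀).IsAdmissible := isAdmissible_iterate hD h.isAdmissible n
    rw [Function.iterate_succ_apply', step_eq_stepWith, mem_jmod_stepWith_iff hD hadm, ← step_eq_stepWith,
      ← Function.iterate_succ_apply' step n, valProd_succ]
    constructor
    · rintro ⟨s, hs, rfl⟩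
      obtain ⟨s', hs', rfl⟩ := (mem_jmod_iterate_iff hD h n s).mp hs
      exact ⟨s', hs', by ring⟩
    · rintro ⟨s', hs', rfl⟩
      exact ⟨valProd x₀ n * s', (mem_jmod_iterate_iff hD h n _).mpr ⟨s', hs', rfl⟩, by ring⟩

/-- `β_n = Π_n⁻¹ ∈ J(x₀)`. [cite: Jozsa2003, §6.3 (α_i ∈ 𝒪)] -/
theorem inv_valProd_mem (hD : ¬ IsSquare D) {x₀ : QuadIrr D} (h : x₀.IsPreReduced) (n : ℕ) :
    (valProd x₀ n)⁻¹ ∈ jmod x₀ := by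
  have h1 : (1 : ℝ) ∈ jmod (step^[n] x₀) := by
    have := intCast_add_mul_val_mem_jmod (step^[n] x₀) 1 0; simpa using this
  obtain ⟨s, hs, hs1⟩ := (mem_jmod_iterate_iff hD h n 1).mp h1
  have h0 := (valProd_pos hD h n).ne'
  have : s = (valProd x₀ n)⁻¹ := by field_simp; linarith
  rwa [this] at hs

/-- **`O = β_{n+1}ℤ + β_nℤ`**: every element of `J(x₀)` has integer coordinates in two consecutive
`β`'s. [cite: Jozsa2003, §6.3 (𝒪 = α_iℤ + α_{i+1}ℤ via J_i = ℤ + γ_iℤ)] -/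
theorem exists_coords_beta (hD : ¬ IsSquare D) {x₀ : QuadIrr D} (h : x₀.IsPreReduced) (n : ℕ) {t : ℝ}
    (ht : t ∈ jmod x₀) : ∃ a b : ℤ, t = a * (valProd x₀ (n + 1))⁻¹ + b * (valProd x₀ n)⁻¹ := by
  have h0 := (valProd_pos hD h (n + 1)).ne'
  have hmem : valProd x₀ (n + 1) * t ∈ jmod (step^[n + 1] x₀) :=
    (mem_jmod_iterate_iff hD h (n + 1) _).mpr ⟨t, ht, rfl⟩
  obtain ⟨a, b, hab⟩ := mem_jmod_iff.mp hmem
  refine ⟨a, b, ?_⟩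
  have key : t = (a + b * (step^[n + 1] x₀).val) / valProd x₀ (n + 1) := by
    rw [← hab]; field_simp
  rw [key, valProd_succ]
  have h1 := (valProd_pos hD h n).ne'
  have h2 : (step^[n + 1] x₀).val ≠ 0 := by linarith [(h.isReduced_iterate_succ hD n).2.2.1]
  field_simp

/-! ### Conjugates of the `β`'s -/

/-- The conjugate product `Π̄_n = ∏_{k=1}^{n} φ̄_k`. [cite: JacobsonWilliams2008, §3.1 (3.18)] -/
def conjProd (x₀ : QuadIrr D) (n : ℕ) : ℝ := ∏ k ∈ Finset.range n, (step^[k + 1] x₀).conj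

/-- `conjOf Π_n = Π̄_n`. [folklore] -/
theorem conjOf_valProd (hD : ¬ IsSquare D) (x₀ : QuadIrr D) (n : ℕ) : conjOf D (valProd x₀ n) = conjProd x₀ n := by
  unfold valProd conjProd
  rw [conjOf_prod hD (fun k => isQD_val _)]
  exact Finset.prod_congr rfl fun k _ => conjOf_val hD _

/-- `Π̄_{n+1} = Π̄_n φ̄_{n+1}`, with `−1 < φ̄_{n+1} < 0`. [cite: JacobsonWilliams2008, §3.3 (3.36)] -/
theorem conjProd_succ (x₀ : QuadIrr D) (n : ℕ) : conjProd x₀ (n + 1) = conjProd x₀ n * (step^[n + 1] x₀).conj := by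
  unfold conjProd; rw [Finset.prod_range_succ]

/-- `Π̄_n ≠ 0` and `|Π̄_{n+1}| < |Π̄_n| ≤ 1`, and signs alternate: `Π̄_n Π̄_{n+1} < 0`… precisely
`0 < (−1)^n Π̄_n`. [cite: Jozsa2003, §6.3 (Remark: ᾱ_i alternate in sign, |ᾱ_i| decreasing)] -/
theorem conjProd_sign (hD : ¬ IsSquare D) {x₀ : QuadIrr D} (h : x₀.IsPreReduced) :
    ∀ n : ℕ, 0 < (-1) ^ n * conjProd x₀ n ∧ |conjProd x₀ n| ≤ 1
  | 0 => by simp [conjProd]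
  | n + 1 => by
    obtain ⟨h1, h2⟩ := conjProd_sign hD h n
    have hc1 := (h.isReduced_iterate_succ hD n).2.2.2.1
    have hc2 := (h.isReduced_iterate_succ hD n).2.2.2.2
    rw [conjProd_succ, pow_succ]
    constructor
    · have : (-1 : ℝ) ^ n * (-1) * (conjProd x₀ n * (step^[n + 1] x₀).conj) =
          ((-1) ^ n * conjProd x₀ n) * (-(step^[n + 1] x₀).conj) := by ring
      rw [this]; exact mul_pos h1 (by linarith)
    · rw [abs_mul]
      have : |(step^[n + 1] x₀).conj| ≤ 1 := abs_le.mpr ⟨by linarith, by linarith⟩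
      exact mul_le_one₀ h2 (abs_nonneg _) this

/-- `|Π̄_{n+1}| < |Π̄_n|`. [cite: Jozsa2003, §6.3 (Remark)] -/
theorem abs_conjProd_succ_lt (hD : ¬ IsSquare D) {x₀ : QuadIrr D} (h : x₀.IsPreReduced) (n : ℕ) :
    |conjProd x₀ (n + 1)| < |conjProd x₀ n| := by
  have hc1 := (h.isReduced_iterate_succ hD n).2.2.2.1
  have hc2 := (h.isReduced_iterate_succ hD n).2.2.2.2
  have h0 : conjProd x₀ n ≠ 0 := by
    have := (conjProd_sign hD h n).1
    intro h0; rw [h0, mul_zero] at this; exact lt_irrefl _ this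
  rw [conjProd_succ, abs_mul]
  have : |(step^[n + 1] x₀).conj| < 1 := abs_lt.mpr ⟨by linarith, by linarith⟩
  calc |conjProd x₀ n| * |(step^[n + 1] x₀).conj| < |conjProd x₀ n| * 1 :=
        mul_lt_mul_of_pos_left this (abs_pos.mpr h0)
    _ = _ := mul_one _

/-- `conjOf β_n = Π̄_n⁻¹`. [folklore] -/
theorem conjOf_inv_valProd (hD : ¬ IsSquare D) {x₀ : QuadIrr D} (h : x₀.IsPreReduced) (n : ℕ) :
    conjOf D (valProd x₀ n)⁻¹ = (conjProd x₀ n)⁻¹ := by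
  rw [conjOf_inv hD (isQD_valProd x₀ n) (valProd_pos hD h n).ne', conjOf_valProd hD]

/-! ### The pinching argument -/

/-- **A minimum `λ ∈ (0, 1]` of `O = J(x₀)` is one of the `β_n`** (for a pre-reduced `x₀`, e.g. the
principal start): the pinching argument of JW Thm. 5.18 — if `β_{n+1} < λ < β_n`, write
`λ = aβ_{n+1} + bβ_n`; minimality against `β_{n+1}` bounds `|λ̄| ≤ |β̄_{n+1}|`, while the
alternating signs of `β̄_n, β̄_{n+1}` force `|λ̄| > |β̄_{n+1}|`. [cite: JacobsonWilliams2008, §5.3 Thm. 5.18 (proof)] -/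
theorem eq_inv_valProd_of_isMinimum (hD : ¬ IsSquare D) {x₀ : QuadIrr D} (h : x₀.IsPreReduced) {lam : ℝ}
    (hmin : IsMinimum D (jmod x₀ : Set ℝ) lam) (hle : lam ≤ 1) : ∃ n : ℕ, lam = (valProd x₀ n)⁻¹ := by
  obtain ⟨hpos, hmem, hmin⟩ := hmin
  set β : ℕ → ℝ := fun n => (valProd x₀ n)⁻¹ with hβ
  have hβpos : ∀ n, 0 < β n := fun n => inv_pos.mpr (valProd_pos hD h n)
  have hβ0 : β 0 = 1 := by simp [hβ, valProd]
  -- `β_{n+2} < β_n / 2`, so some `β_{n+1} < λ`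
  have hβsmall : ∀ m, β (2 * m) ≤ (1 / 2) ^ m := by
    intro m
    induction m with
    | zero => simp [hβ0]
    | succ m ih =>
      have h1 := two_mul_valProd_lt hD h (2 * m)
      have h2 := valProd_pos hD h (2 * m)
      have h3 : (valProd x₀ (2 * m + 2))⁻¹ < (2 * valProd x₀ (2 * m))⁻¹ := inv_strictAnti₀ (by positivity) h1
      rw [show 2 * (m + 1) = 2 * m + 2 by ring, pow_succ]
      simp only [hβ] at ih ⊢
      rw [mul_inv] at h3
      have h4 : (2 : ℝ)⁻¹ * (valProd x₀ (2 * m))⁻¹ ≤ (1 / 2) ^ m * (1 / 2) := by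
        rw [show (2 : ℝ)⁻¹ = 1 / 2 by norm_num, mul_comm]
        exact mul_le_mul_of_nonneg_right ih (by norm_num)
      exact (h3.le).trans h4
  have hex : ∃ n, β (n + 1) < lam := by
    obtain ⟨m, hm⟩ := exists_pow_lt_of_lt_one hpos (by norm_num : (1 / 2 : ℝ) < 1)
    refine ⟨2 * m, ?_⟩
    have h1 : β (2 * m + 1) ≤ β (2 * m) := by
      simp only [hβ]
      rw [valProd_succ]
      apply inv_anti₀ (valProd_pos hD h _)
      have := (h.isReduced_iterate_succ hD (2 * m)).2.2.1
      have := valProd_pos hD h (2 * m)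
      nlinarith
    linarith [hβsmall m]
  set n := Nat.find hex with hn
  have hn1 : β (n + 1) < lam := Nat.find_spec hex
  have hn2 : lam ≤ β n := by
    rcases Nat.eq_zero_or_pos n with h0 | h0
    · rw [h0, hβ0]; exact hle
    · obtain ⟨m, hm⟩ := Nat.exists_eq_succ_of_ne_zero h0.ne'
      have := Nat.find_min hex (show m < n by omega)
      rw [hm]; exact not_lt.mp this
  refine ⟨n, ?_⟩
  rcases hn2.lt_or_eq with hlt | heq
  swap
  · exact heq
  exfalso
  -- coordinates of `λ` in `(β_{n+1}, β_n)` and of its conjugate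
  obtain ⟨a, b, hab⟩ := exists_coords_beta hD h n hmem
  have hβn1_mem : β (n + 1) ∈ jmod x₀ := inv_valProd_mem hD h (n + 1)
  have hconj_bound := hmin (β (n + 1)) hβn1_mem (hβpos _).ne' (by rw [abs_of_pos (hβpos _)]; exact hn1)
  -- conjugates
  have hQa : IsQD D (β (n + 1)) := (isQD_valProd x₀ (n + 1)).inv hD
  have hQb : IsQD D (β n) := (isQD_valProd x₀ n).inv hD
  have hconjlam : conjOf D lam = a * conjOf D (β (n + 1)) + b * conjOf D (β n) := by
    rw [hab, conjOf_add hD ((IsQD.intCast a).mul hQa) ((IsQD.intCast b).mul hQb),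
      conjOf_mul hD (IsQD.intCast a) hQa, conjOf_mul hD (IsQD.intCast b) hQb,
      conjOf_intCast hD, conjOf_intCast hD]
  set c₁ := conjOf D (β (n + 1)) with hc₁
  set c₀ := conjOf D (β n) with hc₀
  have hc₁' : c₁ = (conjProd x₀ (n + 1))⁻¹ := conjOf_inv_valProd hD h (n + 1)
  have hc₀' : c₀ = (conjProd x₀ n)⁻¹ := conjOf_inv_valProd hD h n
  obtain ⟨hs0, -⟩ := conjProd_sign hD h n
  obtain ⟨hs1, -⟩ := conjProd_sign hD h (n + 1)
  have hlt01 := abs_conjProd_succ_lt hD h n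
  have hP0 : conjProd x₀ n ≠ 0 := by intro h0; rw [h0, mul_zero] at hs0; exact lt_irrefl _ hs0
  have hP1 : conjProd x₀ (n + 1) ≠ 0 := by intro h0; rw [h0, mul_zero] at hs1; exact lt_irrefl _ hs1
  -- `c₀ c₁ < 0` and `|c₀| < |c₁|`
  have hopp : c₀ * c₁ < 0 := by
    rw [hc₀', hc₁', ← mul_inv, inv_neg'']
    have : (-1 : ℝ) ^ n * conjProd x₀ n * ((-1) ^ (n + 1) * conjProd x₀ (n + 1)) > 0 := mul_pos hs0 hs1
    rw [pow_succ] at this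
    have e : (-1 : ℝ) ^ n * conjProd x₀ n * ((-1) ^ n * (-1) * conjProd x₀ (n + 1)) =
        -(((-1 : ℝ) ^ n) ^ 2 * (conjProd x₀ n * conjProd x₀ (n + 1))) := by ring
    rw [e] at this
    have hsq : ((-1 : ℝ) ^ n) ^ 2 = 1 := by rw [← pow_mul, mul_comm, pow_mul]; simp
    rw [hsq, one_mul] at this
    linarith
  have habs : |c₀| < |c₁| := by
    rw [hc₀', hc₁', abs_inv, abs_inv]
    exact inv_strictAnti₀ (abs_pos.mpr hP1) hlt01
  have hc₁0 : c₁ ≠ 0 := fun h0 => by rw [h0, mul_zero] at hopp; exact lt_irrefl _ hopp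
  have hc₀0 : c₀ ≠ 0 := fun h0 => by rw [h0, zero_mul] at hopp; exact lt_irrefl _ hopp
  rw [hconjlam] at hconj_bound
  -- real-side constraints
  have hA1 : β (n + 1) < a * β (n + 1) + b * β n := by rw [← hab]; exact hn1
  have hA2 : a * β (n + 1) + b * β n < β n := by rw [← hab]; exact hlt
  have hb0 := hβpos n
  have hb1 := hβpos (n + 1)
  have hbb : β (n + 1) < β n := by linarith
  -- signs of `c₀, c₁`
  have hsigns : (0 < c₁ ∧ c₀ < 0) ∨ (c₁ < 0 ∧ 0 < c₀) := by
    rcases lt_or_gt_of_ne hc₁0 with h1 | h1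
    · right
      refine ⟨h1, ?_⟩
      by_contra hh
      push Not at hh
      have := mul_nonneg_of_nonpos_of_nonpos hh h1.le
      linarith only [this, hopp]
    · left
      refine ⟨h1, ?_⟩
      by_contra hh
      push Not at hh
      have := mul_nonneg hh h1.le
      linarith only [this, hopp]
  have habs₀ := abs_pos.mpr hc₀0
  -- if `a` and `b` have opposite signs (both nonzero), the conjugate is too large
  have hmixed : ∀ {a' b' : ℤ}, 1 ≤ a' → b' ≤ -1 →
      |(a' : ℝ) * c₁ + b' * c₀| ≤ |c₁| → False := by
    intro a' b' ha hb hbd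
    have ha' : (1 : ℝ) ≤ a' := by exact_mod_cast ha
    have hb' : (b' : ℝ) ≤ -1 := by exact_mod_cast hb
    have hsame : (0 ≤ (a' : ℝ) * c₁ ∧ 0 ≤ (b' : ℝ) * c₀) ∨ ((a' : ℝ) * c₁ ≤ 0 ∧ (b' : ℝ) * c₀ ≤ 0) := by
      rcases hsigns with ⟨h1, h0⟩ | ⟨h1, h0⟩
      · left; exact ⟨(mul_pos (by linarith) h1).le, (mul_pos_of_neg_of_neg (by linarith) h0).le⟩
      · right; exact ⟨(mul_neg_of_pos_of_neg (by linarith) h1).le, (mul_neg_of_neg_of_pos (by linarith) h0).le⟩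
    rw [(abs_add_eq_add_abs_iff _ _).mpr hsame, abs_mul, abs_mul] at hbd
    have h1 : |c₁| ≤ |(a' : ℝ)| * |c₁| := le_mul_of_one_le_left (abs_nonneg _) (by rw [abs_of_pos (by linarith)]; exact ha')
    have h2 : |c₀| ≤ |(b' : ℝ)| * |c₀| := le_mul_of_one_le_left (abs_nonneg _) (by rw [abs_of_neg (by linarith)]; linarith)
    linarith only [hbd, h1, h2, habs₀]
  -- case analysis on `a, b`
  rcases lt_trichotomy b 0 with hb | hb | hb
  · have hb' : (b : ℝ) ≤ -1 := by exact_mod_cast Int.le_sub_one_of_lt hb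
    rcases le_or_gt a 0 with ha | ha
    · have ha' : (a : ℝ) ≤ 0 := by exact_mod_cast ha
      have t1 : (a : ℝ) * β (n + 1) ≤ 0 := mul_nonpos_of_nonpos_of_nonneg ha' hb1.le
      have t2 : (b : ℝ) * β n ≤ -β n := by nlinarith only [hb', hb0]
      linarith only [hA1, t1, t2, hb0, hb1]
    · exact hmixed ha (Int.le_sub_one_of_lt hb) hconj_bound
  · subst hb
    simp only [Int.cast_zero, zero_mul, add_zero] at hA1 hA2 hconj_bound
    -- `λ = a β_{n+1}` with `a ≥ 2`
    have ha1 : (1 : ℝ) < a := by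
      by_contra hh
      push Not at hh
      have : (a : ℝ) * β (n + 1) ≤ β (n + 1) := by nlinarith only [hh, hb1]
      linarith only [this, hA1]
    have ha2 : (2 : ℝ) ≤ a := by
      have : 1 < a := by exact_mod_cast ha1
      exact_mod_cast this
    rw [abs_mul, abs_of_pos (by linarith : (0 : ℝ) < a)] at hconj_bound
    have habs₁ := abs_pos.mpr hc₁0
    nlinarith only [hconj_bound, ha2, habs₁]
  · have hb' : (1 : ℝ) ≤ b := by exact_mod_cast hb
    rcases lt_or_ge a 0 with ha | ha
    · -- `a ≤ -1`, `b ≥ 1`: symmetric to the mixed case with the roles of the signs swapped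
      have ha' : (a : ℝ) ≤ -1 := by exact_mod_cast Int.le_sub_one_of_lt ha
      have hsame : (0 ≤ (a : ℝ) * c₁ ∧ 0 ≤ (b : ℝ) * c₀) ∨ ((a : ℝ) * c₁ ≤ 0 ∧ (b : ℝ) * c₀ ≤ 0) := by
        rcases hsigns with ⟨h1, h0⟩ | ⟨h1, h0⟩
        · right; exact ⟨(mul_neg_of_neg_of_pos (by linarith) h1).le, (mul_neg_of_pos_of_neg (by linarith) h0).le⟩
        · left; exact ⟨(mul_pos_of_neg_of_neg (by linarith) h1).le, (mul_pos (by linarith) h0).le⟩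
      rw [(abs_add_eq_add_abs_iff _ _).mpr hsame, abs_mul, abs_mul] at hconj_bound
      have h1 : |c₁| ≤ |(a : ℝ)| * |c₁| := le_mul_of_one_le_left (abs_nonneg _) (by rw [abs_of_neg (by linarith)]; linarith)
      have h2 : |c₀| ≤ |(b : ℝ)| * |c₀| := le_mul_of_one_le_left (abs_nonneg _) (by rw [abs_of_pos (by linarith)]; exact hb')
      linarith only [hconj_bound, h1, h2, habs₀]
    · have ha' : (0 : ℝ) ≤ a := by exact_mod_cast ha
      have t1 : 0 ≤ (a : ℝ) * β (n + 1) := mul_nonneg ha' hb1.le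
      have t2 : β n ≤ (b : ℝ) * β n := le_mul_of_one_le_left hb0.le hb'
      linarith only [hA2, t1, t2]

end QuadIrr

end Literature.NumberTheory.QuadraticFields

end
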